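import Summits.BirchSwinnertonDyer.BirchSwinnertonDyer.Theorems.AdditiveKolyvaginRoadInductionOfLevelSystems
import Summits.BirchSwinnertonDyer.BirchSwinnertonDyer.Theorems.AdditiveKolyvaginRoadLevelMembership
import Summits.BirchSwinnertonDyer.BirchSwinnertonDyer.Theorems.KolyvaginRoadThreeMethod2Step
import HarnessLib

/-!
# Route `AdditiveKolyvaginRoad`, crux `KolyvaginPrimitiveAdditive` (item stmt-BirchSwinnertonDyer-20132):
# S2-ENGINE at a general prime `p`, DICTIONARY LAYER — from a `LevelKolyvaginSystemP` to a non-zero Kolyvagin class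
# over the places of `K`, modulo the level-system-FREE local–global inputs
# (cell `pub/bsd-wall`, lead prover `bsd-wall-akr-p1` g3; `--supports stmt-BirchSwinnertonDyer-20132`, helper;
# p-generic port of zhang3-p1's `Theorems/KolyvaginRoadThreeMethod2InductionOfLevelSystemsDict.lean`)

WHY THIS FILE. `inductionOfLevelSystemsP_of_engineInputs` (p528422) gives S2-ENGINE's conclusion from a
`LevelKolyvaginSystemP` modulo ENGINE-CURRENCY inputs over an arbitrary apparatus. This layer fixes the apparatus to
be indexed by the PLACES of `K` (`Place K`, local spaces `Hv v`, localisations `loc v`, bilinear forms `b v`), pins the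
level structure `L n` by per-place dictionaries (Kummer at the infinite places and at the finite places above no level
prime, TORIC above the level primes), and DISCHARGES from the system `S` and the membership lemmas
(`mem_selQP_iff` ∕ `mem_selRelQP_iff`, p527820) the inputs `hSel`, `hSelRel`, `hB`, `hpl`, `hLF`, `hcE`, `hcL`, `hcT`,
`hfs`; what remains are the level-system-FREE inputs (REC) `hrec`, isotropies `hisoL` ∕ `hisoT`, (Perf) `hperf`,
(Line) `hline`, (Cheb) `hCheb1` ∕ `hCheb2`, (Supply) `hSupply`, discharged by the local–global layer.

WHAT. `coprime_of_admQ_of_kolyvagin` (a BD-admissible prime `q`, `p ∤ q² − 1`, is never a Kolyvagin prime `ℓ`,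
`p ∣ ℓ + 1`), `not_mem_of_kolyvagin_place_P`, and `inductionOfLevelSystemsP_of_dictionaries`. Proof = zhang3-p1's with
`3 ↦ p`, unipotent-admissible ↦ BD-admissible, `GoodLevel` dropped, ordinary ↦ toric.

HONEST FRAMING: theorems only; 0 definitions, 0 named facts, 0 `sorry`; CONDITIONAL on every binder; closes nothing.

References: [cite: WZhang2014, §8.1, Lemma 8.4, §9 proof of Thm. 9.1, Notations (xii), (xiv)] [cite: McCallumLMS1991,
Prop. 3.1, Lemma 5.3] [cite: BertoliniDarmon2005, p. 18].
-/

-- single-conjunct summit: `Summit.BirchSwinnertonDyer.BirchSwinnertonDyer.…` repeats the name by design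
set_option linter.dupNamespace false

noncomputable section

open scoped Classical

namespace Summit.BirchSwinnertonDyer.BirchSwinnertonDyer.Theorems.AdditiveKoly

open WeierstrassCurve NumberField IsDedekindDomain
  Literature.NumberTheory.EllipticCurves Literature.NumberTheory.EllipticCurves.ModularForms
  Literature.NumberTheory.GaloisRepresentations Module
open Summit.BirchSwinnertonDyer.Rank1Residual.X11b.Three.Koly.Method2

variable (W : WeierstrassCurve ℚ) (K : Type) [Field K] [NumberField K] (p : ℕ) [W.IsGloballyMinimal] [Fact p.Prime]

/-- A Bertolini–Darmon admissible prime `q` (`p ∤ q² − 1`) and a Kolyvagin prime `ℓ` (`p ∣ ℓ + 1`, so `p ∣ ℓ² − 1`)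
are distinct, hence coprime. [cite: WZhang2014, Notations (xii), (xiv)] [cite: BertoliniDarmon2005, p. 18] -/
theorem coprime_of_admQ_of_kolyvagin (q : AdmQ W K p) {ℓ : ℕ}
    (hℓ : Zhang2014.IsKolyvaginPrime (W.conductorNorm ℤ) W K p ℓ) : Nat.Coprime q ℓ := by
  refine (Nat.coprime_primes q.2.1 hℓ.1).mpr fun h ↦ ?_
  have hdvd : p ∣ ℓ + 1 := (Zhang2014.IsKolyvaginPrime.dvd hℓ).1
  have hnot : ¬ ((p : ℤ) ∣ ((q : ℕ) : ℤ) ^ 2 - 1) := q.2.2.2.2.1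
  apply hnot
  rw [h]
  have e : ((ℓ : ℕ) : ℤ) ^ 2 - 1 = ((ℓ + 1 : ℕ) : ℤ) * ((ℓ : ℤ) - 1) := by push_cast; ring
  rw [e]
  exact Dvd.dvd.mul_right (Int.natCast_dvd_natCast.mpr hdvd) _

/-- The place of a Kolyvagin prime lies above no admissible prime. [folklore] -/
theorem not_mem_of_kolyvagin_place_P (q : AdmQ W K p) {ℓ : ℕ}
    (hℓ : Zhang2014.IsKolyvaginPrime (W.conductorNorm ℤ) W K p ℓ) (v : HeightOneSpectrum (𝓞 K))
    (hv : (ℓ : 𝓞 K) ∈ v.asIdeal) : ((q : ℕ) : 𝓞 K) ∉ v.asIdeal :=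
  not_mem_asIdeal_of_coprime K (coprime_of_admQ_of_kolyvagin W K p q hℓ).symm v hv

variable [W.IsElliptic] [NeZero (W.conductorNorm ℤ)]
  (Dt : ModularParametrizationData W (W.conductorNorm ℤ)) (β : ℤ) (ι : K →+* ℂ) (c : K ≃ₐ[ℚ] K)
  [Module (ZMod p) (Vp W K p)]

/-- **S2-ENGINE at a general prime, DICTIONARY LAYER: from a `LevelKolyvaginSystemP` to a non-zero Kolyvagin class over
the places of `K`, modulo the level-system-FREE local–global inputs.** Apparatus: local spaces `Hv v` at the places
`v : Place K` with `ZMod p`-linear localisations `loc v` and bilinear forms `b v`; eigenspaces `E s` of complex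
conjugation (dictionary `hE`); per-place conditions `Kum v` (E's Kummer condition: dictionaries `hKumInf`, `hKumFin`),
`Tor v` (TORIC: `hTor`), `Tr ℓ` (transverse at the place `plK ℓ` of the Kolyvagin prime `ℓ`: `hTr`), strict vanishing
(`hZero`: `torsionLocalKer_v = ker loc_v`); the level structure `L n` pinned by `hLinf` ∕ `hLkum` ∕ `hLtor`; the places
`plK` ∕ `plQ` of the Kolyvagin ∕ admissible primes (`hplK`, `hplQ`). Level-system-free inputs kept as hypotheses: (REC)
`hrec`, isotropy `hisoL` ∕ `hisoT`, (Perf) `hperf`, (Line) `hline`, (Cheb) `hCheb1` ∕ `hCheb2`, (Supply) `hSupply`.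
DISCHARGED here from the system `S` and the membership lemmas: `hSel`, `hSelRel`, `hB`, `hpl`, `hLF`, `hcE`, `hcL`,
`hcT`, `hfs`, (A2), (A5), the witness. [cite: WZhang2014, §8.1, Lemma 8.4, §9 proof of Thm. 9.1]
[cite: McCallumLMS1991, Prop. 3.1, Lemma 5.3] -/
theorem inductionOfLevelSystemsP_of_dictionaries (hp2 : p ≠ 2) (hK : IsImaginaryQuadratic K)
    (S : LevelKolyvaginSystemP W K p Dt β ι c)
    {Hv : Place K → Type} [∀ v, AddCommGroup (Hv v)] [∀ v, Module (ZMod p) (Hv v)]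
    (loc : (v : Place K) → Vp W K p →ₗ[ZMod p] Hv v) (b : (v : Place K) → Hv v →ₗ[ZMod p] Hv v →ₗ[ZMod p] ZMod p)
    (E : Bool → Submodule (ZMod p) (Vp W K p))
    (Kum : (v : Place K) → Submodule (ZMod p) (Hv v))
    (Tor : (v : HeightOneSpectrum (𝓞 K)) → Submodule (ZMod p) (Hv (Sum.inr v)))
    (plK : {ℓ // Zhang2014.IsKolyvaginPrime (W.conductorNorm ℤ) W K p ℓ} → HeightOneSpectrum (𝓞 K))
    (plQ : AdmQ W K p → HeightOneSpectrum (𝓞 K))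
    (Tr : (ℓ : {ℓ // Zhang2014.IsKolyvaginPrime (W.conductorNorm ℤ) W K p ℓ}) →
      Submodule (ZMod p) (Hv (Sum.inr (plK ℓ))))
    (L : Finset (AdmQ W K p) → (v : Place K) → Submodule (ZMod p) (Hv v))
    -- the places of the Kolyvagin ∕ admissible primes
    (hplK : ∀ ℓ, ((ℓ : ℕ) : 𝓞 K) ∈ (plK ℓ).asIdeal) (hplQ : ∀ q, ((q : ℕ) : 𝓞 K) ∈ (plQ q).asIdeal)
    -- per-place dictionaries with the tree's global currency
    (hE : ∀ (s : Bool) (x : Vp W K p), x ∈ E s ↔ conjAct W c ((p ^ 1 : ℕ) : ℤ) x = sgnP s • x)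
    (hKumInf : ∀ (w : InfinitePlace K) (x : Vp W K p),
      x ∈ selmerLocalKer (W.baseChange K) w.Completion ((p ^ 1 : ℕ) : ℤ) ↔ loc (Sum.inl w) x ∈ Kum (Sum.inl w))
    (hKumFin : ∀ (v : HeightOneSpectrum (𝓞 K)) (x : Vp W K p),
      x ∈ selmerLocalKer (W.baseChange K) (v.adicCompletion K) ((p ^ 1 : ℕ) : ℤ) ↔ loc (Sum.inr v) x ∈ Kum (Sum.inr v))
    (hTor : ∀ (v : HeightOneSpectrum (𝓞 K)) (x : Vp W K p),
      x ∈ toricLocalKer (W.baseChange K) (v.adicCompletion K) ((p ^ 1 : ℕ) : ℤ) ↔ loc (Sum.inr v) x ∈ Tor v)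
    (hTr : ∀ (ℓ : {ℓ // Zhang2014.IsKolyvaginPrime (W.conductorNorm ℤ) W K p ℓ}) (x : Vp W K p),
      x ∈ transverseLocalKerP W K p ι ℓ (plK ℓ) ↔ loc (Sum.inr (plK ℓ)) x ∈ Tr ℓ)
    (hZero : ∀ (v : HeightOneSpectrum (𝓞 K)) (x : Vp W K p),
      x ∈ (W.baseChange K).torsionLocalKer (v.adicCompletion K) ((p ^ 1 : ℕ) : ℤ) ↔ loc (Sum.inr v) x = 0)
    -- the level structure
    (hLinf : ∀ (n : Finset (AdmQ W K p)) (w : InfinitePlace K), L n (Sum.inl w) = Kum (Sum.inl w))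
    (hLkum : ∀ (n : Finset (AdmQ W K p)) (v : HeightOneSpectrum (𝓞 K)),
      (∀ q ∈ n, ((q : ℕ) : 𝓞 K) ∉ v.asIdeal) → L n (Sum.inr v) = Kum (Sum.inr v))
    (hLtor : ∀ (n : Finset (AdmQ W K p)) (v : HeightOneSpectrum (𝓞 K)), ∀ q ∈ n,
      ((q : ℕ) : 𝓞 K) ∈ v.asIdeal → L n (Sum.inr v) = Tor v)
    -- level-system-free local–global inputs
    (hisoL : ∀ (n : Finset (AdmQ W K p)) (v : Place K), ∀ x ∈ L n v, ∀ y ∈ L n v, b v x y = 0)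
    (hisoT : ∀ (ℓ : {ℓ // Zhang2014.IsKolyvaginPrime (W.conductorNorm ℤ) W K p ℓ}), ∀ x ∈ Tr ℓ, ∀ y ∈ Tr ℓ,
      b (Sum.inr (plK ℓ)) x y = 0)
    (hperf : ∀ (ℓ : {ℓ // Zhang2014.IsKolyvaginPrime (W.conductorNorm ℤ) W K p ℓ}) (s : Bool), ∀ x ∈ E s, ∀ y ∈ E s,
      loc (Sum.inr (plK ℓ)) x ∈ Kum (Sum.inr (plK ℓ)) →
      loc (Sum.inr (plK ℓ)) x ≠ 0 → loc (Sum.inr (plK ℓ)) y ∈ Tr ℓ → loc (Sum.inr (plK ℓ)) y ≠ 0 →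
      b (Sum.inr (plK ℓ)) (loc (Sum.inr (plK ℓ)) x) (loc (Sum.inr (plK ℓ)) y) ≠ 0)
    (hline : ∀ (ℓ : {ℓ // Zhang2014.IsKolyvaginPrime (W.conductorNorm ℤ) W K p ℓ}) (s : Bool),
      ∃ e : Hv (Sum.inr (plK ℓ)), ∀ x ∈ E s,
      loc (Sum.inr (plK ℓ)) x ∈ Kum (Sum.inr (plK ℓ)) → ∃ a : ZMod p, loc (Sum.inr (plK ℓ)) x = a • e)
    (hrec : ∀ (x y : Vp W K p) (T : Finset (Place K)), (∀ v, v ∉ T → b v (loc v x) (loc v y) = 0) →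
      ∑ v ∈ T, b v (loc v x) (loc v y) = 0)
    (hCheb1 : ∀ x : Vp W K p, x ≠ 0 → ∀ T : Finset {ℓ // Zhang2014.IsKolyvaginPrime (W.conductorNorm ℤ) W K p ℓ},
      ∃ ℓ, ℓ ∉ T ∧ loc (Sum.inr (plK ℓ)) x ≠ 0)
    (hCheb2 : ∀ (s : Bool), ∀ x ∈ E s, ∀ y ∈ E (!s), x ≠ 0 → y ≠ 0 →
      ∀ T : Finset {ℓ // Zhang2014.IsKolyvaginPrime (W.conductorNorm ℤ) W K p ℓ},
      ∃ ℓ, ℓ ∉ T ∧ loc (Sum.inr (plK ℓ)) x ≠ 0 ∧ loc (Sum.inr (plK ℓ)) y ≠ 0)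
    (hSupply : ∀ (n : Finset (AdmQ W K p)), n.Nonempty →
      ∀ (ℓ : {ℓ // Zhang2014.IsKolyvaginPrime (W.conductorNorm ℤ) W K p ℓ}) (T : Finset _), ℓ ∉ T →
      ∀ s : Bool, ∃ x ∈ E s, x ≠ 0 ∧
        (∀ v : Place K, v ≠ Sum.inr (plK ℓ) → (∀ ℓ' ∈ T, Sum.inr (plK ℓ') ≠ v) → loc v x ∈ L n v) ∧
        ∀ ℓ' ∈ T, loc (Sum.inr (plK ℓ')) x ∈ Tr ℓ')
    -- (A1) at the frame, the parity and the rank ≥ 3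
    (hA1 : ∀ (n : Finset (AdmQ W K p)) (μ : Bool) (x : Vp W K p),
      x ∈ SelQP W K p c n μ → x ≠ 0 →
      ∃ q : AdmQ W K p, q ∉ n ∧
        x ∉ SelQP W K p c (insert q n) μ ∧
        SelQP W K p c (insert q n) μ ≤ SelQP W K p c n μ ∧
        finrank (ZMod p) (SelQP W K p c (insert q n) μ) + 1 = finrank (ZMod p) (SelQP W K p c n μ) ∧
        SelQP W K p c (insert q n) (!μ) = SelQP W K p c n (!μ))
    (hodd : Odd (finrank (ZMod p)
      (AddSubgroup.toZModSubmodule p (selmerGroup (W.baseChange K) ((p ^ 1 : ℕ) : ℤ)))))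
    (h3 : 3 ≤ finrank (ZMod p)
      (AddSubgroup.toZModSubmodule p (selmerGroup (W.baseChange K) ((p ^ 1 : ℕ) : ℤ)))) :
    ∃ (n : ℕ) (d : KolyvaginHeegnerData Dt β ι n),
      KolyvaginDescent.KolSupp (Zhang2014.IsKolyvaginPrime (W.conductorNorm ℤ) W K p) n ∧
        d.kolyvaginClass (Fact.out : p.Prime) 1 ≠ 0 := by
  -- uniqueness of the places above the inert primes (a non-zero prime of a Dedekind domain is maximal)
  have huniq : ∀ {q : ℕ}, (Ideal.span {(q : 𝓞 K)}).IsPrime → q ≠ 0 → ∀ {v v' : HeightOneSpectrum (𝓞 K)},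
      (q : 𝓞 K) ∈ v.asIdeal → (q : 𝓞 K) ∈ v'.asIdeal → v' = v := by
    intro q hq hq0 v v' hv hv'
    have key : ∀ w : HeightOneSpectrum (𝓞 K), (q : 𝓞 K) ∈ w.asIdeal → w.asIdeal = Ideal.span {(q : 𝓞 K)} := by
      intro w hw
      have hle : Ideal.span {(q : 𝓞 K)} ≤ w.asIdeal := by
        rw [Ideal.span_le, Set.singleton_subset_iff]
        exact hw
      have hne : Ideal.span {(q : 𝓞 K)} ≠ ⊥ := by
        rw [Ne, Ideal.span_singleton_eq_bot]
        exact_mod_cast hq0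
      exact ((hq.isMaximal hne).eq_of_le w.isPrime.ne_top hle).symm
    exact HeightOneSpectrum.ext (by rw [key v hv, key v' hv'])
  have hKuniq : ∀ (ℓ : {ℓ // Zhang2014.IsKolyvaginPrime (W.conductorNorm ℤ) W K p ℓ}) (v : HeightOneSpectrum (𝓞 K)),
      ((ℓ : ℕ) : 𝓞 K) ∈ v.asIdeal → v = plK ℓ :=
    fun ℓ v hv ↦ huniq ℓ.2.2.2.2.2.1 ℓ.2.1.ne_zero (hplK ℓ) hv
  have hQuniq : ∀ (q : AdmQ W K p) (v : HeightOneSpectrum (𝓞 K)), ((q : ℕ) : 𝓞 K) ∈ v.asIdeal → v = plQ q :=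
    fun q v hv ↦ huniq q.2.2.2.1 q.2.1.ne_zero (hplQ q) hv
  -- membership dictionary for the canonical spaces
  have hSel : ∀ (n : Finset (AdmQ W K p)) (s : Bool) (x : Vp W K p),
      x ∈ SelQP W K p c n s ↔ x ∈ E s ∧ ∀ v, loc v x ∈ L n v := by
    intro n s x
    rw [mem_selQP_iff, hE]
    refine and_congr_right fun _ ↦ ⟨fun ⟨hinf, hfin, htor⟩ v ↦ ?_, fun h ↦ ⟨fun w ↦ ?_, fun v hv ↦ ?_,
      fun q hq v hv ↦ ?_⟩⟩
    · rcases v with w | v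
      · rw [hLinf]; exact (hKumInf w x).mp (hinf w)
      · by_cases hv : ∃ q ∈ n, ((q : ℕ) : 𝓞 K) ∈ v.asIdeal
        · obtain ⟨q, hq, hqv⟩ := hv
          rw [hLtor n v q hq hqv]; exact (hTor v x).mp (htor q hq v hqv)
        · push Not at hv
          rw [hLkum n v hv]; exact (hKumFin v x).mp (hfin v hv)
    · have := h (Sum.inl w); rw [hLinf] at this; exact (hKumInf w x).mpr this
    · have := h (Sum.inr v); rw [hLkum n v hv] at this; exact (hKumFin v x).mpr this
    · have := h (Sum.inr v); rw [hLtor n v q hq hv] at this; exact (hTor v x).mpr this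
  -- membership dictionary for the spaces relaxed at the base locus
  have hSelRel : ∀ (n : Finset (AdmQ W K p)) (s : Bool) (x : Vp W K p),
      x ∈ SelRelQP W K p c n (baseLocusQP W K p S.κ n) s ↔
        x ∈ E s ∧ ∀ v, v ∉ (fun q ↦ (Sum.inr (plQ q) : Place K)) '' baseLocusQP W K p S.κ n → loc v x ∈ L n v := by
    intro n s x
    rw [mem_selRelQP_iff, hE]
    refine and_congr_right fun _ ↦ ⟨fun ⟨hinf, hfin, htor⟩ v hvB ↦ ?_, fun h ↦ ⟨fun w ↦ ?_, fun v hv hvS ↦ ?_,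
      fun q hq hqS v hv ↦ ?_⟩⟩
    · rcases v with w | v
      · rw [hLinf]; exact (hKumInf w x).mp (hinf w)
      · by_cases hv : ∃ q ∈ n, ((q : ℕ) : 𝓞 K) ∈ v.asIdeal
        · obtain ⟨q, hq, hqv⟩ := hv
          have hqS : q ∉ baseLocusQP W K p S.κ n := fun h ↦ hvB ⟨q, h, by rw [hQuniq q v hqv]⟩
          rw [hLtor n v q hq hqv]; exact (hTor v x).mp (htor q hq hqS v hqv)
        · push Not at hv
          have hvS : ∀ q ∈ baseLocusQP W K p S.κ n, ((q : ℕ) : 𝓞 K) ∉ v.asIdeal :=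
            fun q hq hqv ↦ hvB ⟨q, hq, by rw [hQuniq q v hqv]⟩
          rw [hLkum n v hv]; exact (hKumFin v x).mp (hfin v hv hvS)
    · have := h (Sum.inl w) (by rintro ⟨q, -, hq⟩; exact Sum.inr_ne_inl hq)
      rw [hLinf] at this; exact (hKumInf w x).mpr this
    · have := h (Sum.inr v) (by
        rintro ⟨q, hq, hqv⟩
        exact hvS q hq ((Sum.inr_injective hqv) ▸ hplQ q))
      rw [hLkum n v hv] at this; exact (hKumFin v x).mpr this
    · have := h (Sum.inr v) (by
        rintro ⟨q', hq', hq'v⟩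
        have hvq' : v = plQ q' := (Sum.inr_injective hq'v).symm
        have hqq' : q = q' := by
          by_contra hne
          have hcop : Nat.Coprime (q' : ℕ) (q : ℕ) := (Nat.coprime_primes q'.2.1 q.2.1).mpr
            (fun h ↦ hne (Subtype.ext h.symm))
          exact not_mem_asIdeal_of_coprime K hcop v (hvq' ▸ hplQ q') hv
        exact hqS (hqq' ▸ hq'))
      rw [hLtor n v q hq hv] at this; exact (hTor v x).mpr this
  -- the classes vanish on the base locus
  have hB : ∀ n, ∀ q ∈ baseLocusQP W K p S.κ n, ∀ m, loc (Sum.inr (plQ q)) (S.κ m n) = 0 :=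
    fun n q hq m ↦ (hZero (plQ q) _).mp (hq m (plQ q) (hplQ q))
  -- the Kolyvagin places are pairwise distinct and carry the Kummer condition at every level
  have hpl : Function.Injective (fun ℓ ↦ (Sum.inr (plK ℓ) : Place K)) := by
    intro ℓ ℓ' h
    have h' : plK ℓ = plK ℓ' := Sum.inr_injective h
    by_contra hne
    have hcop : Nat.Coprime (ℓ : ℕ) (ℓ' : ℕ) := (Nat.coprime_primes ℓ.2.1 ℓ'.2.1).mpr (fun h ↦ hne (Subtype.ext h))
    exact not_mem_asIdeal_of_coprime K hcop (plK ℓ) (hplK ℓ) (h' ▸ hplK ℓ')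
  have hLF : ∀ n ℓ, L n (Sum.inr (plK ℓ)) = Kum (Sum.inr (plK ℓ)) := fun n ℓ ↦
    hLkum n (plK ℓ) fun q _ ↦ not_mem_of_kolyvagin_place_P W K p q ℓ.2 (plK ℓ) (hplK ℓ)
  -- the Kolyvagin-system readings of the classes
  have hcE : ∀ (n : Finset (AdmQ W K p)), n.Nonempty → ∀ m, S.κ m n ∈ E (S.ε₀ n ^^ Nat.bodd m.card) :=
    fun n hn m ↦ (hE _ _).mpr (S.sign n hn m)
  have hcL : ∀ (n : Finset (AdmQ W K p)), n.Nonempty → ∀ m (v : Place K),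
      (∀ ℓ ∈ m, (Sum.inr (plK ℓ) : Place K) ≠ v) → loc v (S.κ m n) ∈ L n v := by
    intro n hn m v hv
    rcases v with w | v
    · rw [hLinf]; exact (hKumInf w _).mp (S.selmer_inf n hn m w)
    · by_cases hvn : ∃ q ∈ n, ((q : ℕ) : 𝓞 K) ∈ v.asIdeal
      · obtain ⟨q, hq, hqv⟩ := hvn
        rw [hLtor n v q hq hqv]; exact (hTor v _).mp (S.toric_on n hn m q hq v hqv)
      · push Not at hvn
        have hvm : ∀ ℓ ∈ m, ((ℓ : ℕ) : 𝓞 K) ∉ v.asIdeal := fun ℓ hℓ hℓv ↦ hv ℓ hℓ (by rw [hKuniq ℓ v hℓv])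
        rw [hLkum n v hvn]; exact (hKumFin v _).mp (S.selmer_off n hn m v hvm hvn)
  have hcT : ∀ (n : Finset (AdmQ W K p)), n.Nonempty → ∀ m, ∀ ℓ ∈ m, loc (Sum.inr (plK ℓ)) (S.κ m n) ∈ Tr ℓ :=
    fun n hn m ℓ hℓ ↦ (hTr ℓ _).mp (S.transverse_on n hn m ℓ hℓ (plK ℓ) (hplK ℓ))
  have hfs : ∀ (n : Finset (AdmQ W K p)), n.Nonempty → ∀ m ℓ, ℓ ∉ m →
      (loc (Sum.inr (plK ℓ)) (S.κ (insert ℓ m) n) = 0 ↔ loc (Sum.inr (plK ℓ)) (S.κ m n) = 0) := by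
    intro n hn m ℓ hℓ
    rw [← hZero, ← hZero]
    exact S.relation n hn m ℓ hℓ (plK ℓ) (hplK ℓ)
  exact inductionOfLevelSystemsP_of_engineInputs W K p Dt β ι c hp2 hK S E loc b L (fun ℓ ↦ Sum.inr (plK ℓ))
    (fun q ↦ Sum.inr (plQ q)) (fun ℓ ↦ Kum (Sum.inr (plK ℓ))) Tr hSel hSelRel hB hpl hLF hisoL hisoT hperf hline
    hrec hcE hcL hcT hfs hCheb1 hCheb2 hSupply hA1 hodd h3

end Summit.BirchSwinnertonDyer.BirchSwinnertonDyer.Theorems.AdditiveKoly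

end
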